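import Literature.NumberTheory.EllipticCurves.ModularCurve
import Literature.NumberTheory.EllipticCurves.GlobalMinimalModel
import Literature.NumberTheory.EllipticCurves.GaloisAction
import Literature.NumberTheory.DiophantineGeometry.Conductor
import Literature.NumberTheory.DiophantineGeometry.TateAlgorithm
import Literature.NumberTheory.DiophantineGeometry.KodairaSymbol
import HarnessLib
import HarnessLib.Audit.Tags

/-!
# Candidates E-desc-3 / E-desc-3T: the COMPONENT-EXPONENT DEGREE LAW for optimal modular degrees
# (`ComponentExponentDegreeLaw`, irreducibility-keyed; `ComponentExponentDegreeLawTorsion`, torsion-keyed)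
# — cell `bsd-f2-manin` (D-0131 (3) frontier: the Manin constant at additive primes). `@[conjecture]`
# leaf (NOTHING asserted; definitions only).

HONEST FRAMING. LENS = descent / visibility / component groups under additive base change (planner
`bsd-f2-manin-desc` g1, HOME `run/shared/lean/pub/bsd-f2-manin/MEMO-desc.md` §§7–17), Props VERBATIM
from HOME/desc/Sketch-desc-g1.lean (audited text 1d824c449d157e97 = current cdb5e28549c44781 on these
defs; farm rc 0) with the sketch's local table `componentGroupExponent` replaced by the tree's
`KodairaSymbol.componentGroupExponent` (landed for this purpose, p547650: `I_n ↦ max n 1`,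
`II, II* ↦ 1`, `III, III* ↦ 2`, `IV, IV* ↦ 3`, `I_n* ↦ 2` (`n` even) / `4` (`n` odd) — the EXPONENT of
the geometric Néron component group, NOT its order: the order variant has 48 violations, e.g. 99d1,
`I₁*` at 3 with `4 ∤ deg φ₀`, REFUTER-ref1 §R3). Binder block = the landed `ManinCongruenceDefectLaw`:
`W` a globally minimal model, `D` an `X₀(N)`-parametrisation datum at the CONDUCTOR level with the
lattice clause `Λ_W = c·Λ_f` (refuter-1 traps T1/T2/T3) and of minimal degree among the data at level
`N` with the same newform (`D.deg = m_E = deg φ₀` of the optimal curve); the Kodaira symbol of `W` at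
the place `(q)` is `WeierstrassCurve.kodairaSymbolAt` (Tate's algorithm; `I₀` for `q ∤ N`, empty clause).

THE ROWS. E-desc-3 (CEL): for every prime `q` and every prime `ℓ` with `E[ℓ]` irreducible,
`ℓ^{v_ℓ(exp Φ_q(E))} ∣ deg φ₀`. E-desc-3T (CEL-T, the headline per the planner, MEMO-desc §14): the
same with «`E[ℓ]` irreducible» WEAKENED to «the optimal curve has no rational point of order `ℓ`»
(`∀ P : W.toAffine.Point, addOrderOf P ≠ ℓ`). Informally CEL-T ⟹ CEL (an irreducible `E[ℓ]` has no
rational line); the formal edge needs the comparison `W(ℚ)[ℓ] ↪ geomTorsion W ℓ` and is not proved here.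
BC5 WITNESS (MEMO-desc §§13–15, HOME/desc/addlaw-*.txt; refuter-1's own Tate/Kodaira census N < 10⁵):
CEL 0 violations / 752 865 irreducible `(class, q, ℓ)` incidences incl. `ℓ = q` and `ℓ = 2`; CEL-T 0 /
24 265 further reducible-without-`ℓ`-point incidences; every CEL violator with reducible `E[ℓ]` carries a
rational `ℓ`-point ON the optimal curve. Refuter verdicts: REF1 **E-desc-3 SURVIVES, E-desc-3T SURVIVES**
2026-08-27T16:22Z (HOME/REFUTER-ref1.md §R3; 7 crux probes CLEAN, HOME/ref1-C7-desc-g1.lean); REF2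
(HOME/REFUTER-ref2.md, v3 §C″): SPLIT — multiplicative `q` and additive `q ≥ 5` IN-PRINT-IMPLICIT
(Eisenstein route: `[m_E] = ω_*ω^*` on `Φ_q` Takahashi 2001, `Φ_q(J₀(qM))` Eisenstein Ribet 1990 Thm 3.12,
Edixhoven 1991 for `q > 3`; printed verbatim for square-free `N`: Takahashi 2001 Thm 2.3 / Ribet–Takahashi
1997 Prop 3); additive `q ∈ {2, 3}`: `ℓ = 2` exponent-2 IN PRINT (Calegari–Emerton 2009 Thm 1, tree fact
`calegariEmerton_oddModularDegree`), `(q, ℓ) = (2, 3)` on `4 ∥ N` FOLKLORE-PROVABLE (the cell's E-an-4a),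
`(3, 3)` NOT-IN-PRINT, exponent-4 (`I_n*`, `n` odd, at `q ∈ {2, 3}`) OPEN-NEW; CEL-T clause (ii) (an
`ℓ`-point in the class but not on the optimal curve, and all `q ∈ {2, 3}`) NOT-IN-PRINT / OPEN-NEW.
The planner's Eisenstein split of CEL into the print range and the wild residue (MEMO-desc §17, rows
E-desc-7/8) is typed separately once audited.
-/

noncomputable section

open scoped MatrixGroups ModularForm

open CongruenceSubgroup WeierstrassCurve
  Literature.NumberTheory.EllipticCurves Literature.NumberTheory.EllipticCurves.ModularForms
  Literature.NumberTheory.DiophantineGeometry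

namespace Summit.BirchSwinnertonDyer.Rank1Residual.ManinAdditive

/-- **Candidate E-desc-3 `ComponentExponentDegreeLaw` (CEL; cell bsd-f2-manin; a LAW, in print only on
the Eisenstein range, nothing asserted):** for every globally minimal elliptic `W/ℚ` with conductor
`N = W.conductorNorm ℤ`, every `X₀(N)`-parametrisation datum `D` at level `N` with the lattice clause
and of minimal degree among the data at level `N` with the same newform, every prime `q` and every
prime `ℓ` at which the mod-`ℓ` representation of `W` is irreducible:
`ℓ ^ v_ℓ(exp Φ_q(W)) ∣ D.modularDegree`, the exponent read off the Kodaira symbol of `W` at `(q)`.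
[cite: Takahashi2001, Thm 2.3 (p. 6: «j_r divides δ», the square-free case; the law at p² ∣ N, in
particular at q ∈ {2, 3}, is NOT in print — cell bsd-f2-manin MEMO-desc.md §§7–17, E-desc-3)] -/
@[conjecture] def ComponentExponentDegreeLaw : Prop :=
  ∀ (W : WeierstrassCurve ℚ) [W.IsElliptic] [W.IsGloballyMinimal] [NeZero (W.conductorNorm ℤ)]
    (D : ModularParametrizationData W (W.conductorNorm ℤ)),
    (∀ z ∈ D.L.lattice, ∃ w ∈ periodLattice D.f, z = D.c * w) →
    (∀ (W' : WeierstrassCurve ℚ) [W'.IsElliptic]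
        (D' : ModularParametrizationData W' (W.conductorNorm ℤ)),
        D'.f = D.f → D.modularDegree ≤ D'.modularDegree) →
    ∀ (q : ℕ) (hq : q.Prime) (ℓ : ℕ), ℓ.Prime → W.HasIrreducibleModPGaloisRep ℓ →
      ℓ ^ padicValNat ℓ
        (W.kodairaSymbolAt ((Rat.HeightOneSpectrum.primesEquiv (R := ℤ)).symm ⟨q, hq⟩)).componentGroupExponent ∣
        D.modularDegree

/-- **Candidate E-desc-3T `ComponentExponentDegreeLawTorsion` (CEL-T; cell bsd-f2-manin; the
torsion-keyed headline form, nothing asserted):** the same law with the hypothesis «`E[ℓ]` irreducible»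
weakened to «`W` has no rational point of order `ℓ`» (`∀ P : W.toAffine.Point, addOrderOf P ≠ ℓ`).
[cite: Takahashi2001, Thm 2.3 (p. 6, square-free case only; the torsion-keyed law at composite N is
NOT in print — cell bsd-f2-manin MEMO-desc.md §14, E-desc-3T)] -/
@[conjecture] def ComponentExponentDegreeLawTorsion : Prop :=
  ∀ (W : WeierstrassCurve ℚ) [W.IsElliptic] [W.IsGloballyMinimal] [NeZero (W.conductorNorm ℤ)]
    (D : ModularParametrizationData W (W.conductorNorm ℤ)),
    (∀ z ∈ D.L.lattice, ∃ w ∈ periodLattice D.f, z = D.c * w) →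
    (∀ (W' : WeierstrassCurve ℚ) [W'.IsElliptic]
        (D' : ModularParametrizationData W' (W.conductorNorm ℤ)),
        D'.f = D.f → D.modularDegree ≤ D'.modularDegree) →
    ∀ (q : ℕ) (hq : q.Prime) (ℓ : ℕ), ℓ.Prime → (∀ P : W.toAffine.Point, addOrderOf P ≠ ℓ) →
      ℓ ^ padicValNat ℓ
        (W.kodairaSymbolAt ((Rat.HeightOneSpectrum.primesEquiv (R := ℤ)).symm ⟨q, hq⟩)).componentGroupExponent ∣
        D.modularDegree

end Summit.BirchSwinnertonDyer.Rank1Residual.ManinAdditive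

end
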